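import Literature.Analysis.FluidPDE.KNSSLiouville
import HarnessLib

/-!
# KNSS 2009: the planar vorticity and the regularity of bounded weak solutions on `ℝ² × (−∞, 0)`

Analysis/FluidPDE facts file on the decomposition path of the named fact
`Literature.Analysis.FluidPDE.KNSS2009_liouville_planar` (Koch–Nadirashvili–Seregin–Šverák,
Acta Math. 203 (2009) = arXiv:0709.3599, **Theorem 5.1**, p. 9: a bounded weak solution of the
Navier–Stokes equations in `ℝ² × (−∞, 0)` is `u(x, t) = b(t)`). The printed proof (p. 9) has four
steps: (1) by §4, `u` is smooth in `x` with all derivatives bounded, and the scalar vorticity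
`ω = u_{2,1} − u_{1,2}` solves the vorticity equation `ωₜ + u·∇ω − Δω = 0` with `ωₜ` bounded (the
two displays following the statement of Theorem 5.1); (2) if `M₁ = sup ω > 0`, Lemma 2.1 gives
arbitrarily large parabolic balls on which `ω ≥ M₁/2`; (3) this contradicts
`∫_{Q_R} ω = ∫∫_{∂B_R} (u₂n₁ − u₁n₂) ≤ C R³`, so `ω ≡ 0`; (4) `curl u = 0`, `div u = 0` and
boundedness make `u(·, t)` constant (Liouville).

Steps (2)–(4) are proved in the tree from two named facts
(`Literature.Analysis.FluidPDE.KNSSLiouvillePlanar`): Lemma 2.1 in half-ball form, already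
vendored for every finite-dimensional space as
`Literature.Analysis.FluidPDE.KNSS2009_lemma21_halfball` (`KNSSRegularity`), and step (1), the
**planar case of the §4 regularity theory**, vendored here as
`Literature.Analysis.FluidPDE.KNSS2009_regularity_boundedWeak_ancient_planar`. It is the `ℝ²`
twin of the accepted `ℝ³` fact
`Literature.Analysis.FluidPDE.KNSS2009_regularity_boundedWeak_ancient` (same source lines — the
`L^∞` bounds `‖∇ᵏₓu‖_{L^∞(ℝⁿ×(δ,T))} ≤ C(k, δ, T, M)` and `‖∇ᵏₓ∂ₜ(u − b)‖_{L^∞(ℝⁿ×(δ,T))} ≤ C`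
closing §4, with Lemma 3.1 —; same rendering through an everywhere-defined representative
`U + b(t)` with smooth slices, classical derivatives `iteratedFDeriv`, a jointly measurable `U`,
and the vorticity equation in time-integrated form), with the one difference the dimension forces:
in the plane the vorticity is the *scalar* `ω = ∂₁u₂ − ∂₂u₁` and its equation has no stretching
term. KNSS's §4 is written for general `n` ("`u : ℝⁿ × (0, T) → ℝⁿ`", pp. 6–8); the tree's `curl`
is three-dimensional, whence a separate planar statement rather than a generalisation of the `ℝ³`
one.

This file also introduces the planar vocabulary the fact is stated in:

* `Literature.Analysis.FluidPDE.curl2 v x = Dv(x)e₀ · e₁ − Dv(x)e₁ · e₀` (`= ∂₁v₂ − ∂₂v₁`, KNSS's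
  `ω = u_{2,1} − u_{1,2}`, indices `0, 1` in Lean), the scalar curl of a planar field — the third
  component of the tree's `curl` for a field that does not depend on `x₃`;
* `Literature.Analysis.FluidPDE.curl2CLM`, the same expression as a continuous linear form of the
  velocity gradient, with `curl2 v = curl2CLM ∘ Dv` (`curl2_eq_comp`), so that smoothness and
  derivative bounds of `ω` are those of `Dv` (used in `KNSSLiouvillePlanar`).

Nothing deep is proved here (`rfl`/`simp` API only).

## Rendering choices (as for the `ℝ³` fact, `KNSSRegularity`)

* `u ∈ L^∞(ℝ² × (−∞, 0))` is an equivalence class; the §4 bounds are `L^∞` bounds on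
  distributional derivatives. We render them through `U : ℝ → ℝ² → ℝ²`, `b : ℝ → ℝ²` with
  `u t =ᵐ U t + b t` for a.e. `t < 0` (`b` the parasitic part of Lemma 3.1, bounded measurable with
  `‖b‖_{L^∞(0,T)} ≤ C(T)‖u‖_{L^∞}`), smooth divergence-free slices `U t`, bounds on
  `iteratedFDeriv ℝ k (U t)` uniform on `(−∞, 0)` ("By the results of Section 4, the function `ω`
  is uniformly bounded together with its spatial derivatives", p. 9 — uniformity on `(−∞, 0)` by
  time translation of the window estimates `C(k, δ, T, M)`), Lipschitz dependence on `t` of the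
  derivatives of order `≥ 1` (`‖∇ᵏₓ∂ₜ(u − b)‖_{L^∞} ≤ C`; order `0` is not asserted, see
  `KNSSRegularity`: a global `b` on `(−∞, 0)` is glued from windows, Remark 3.1), and joint
  measurability of `U` (free in the construction `U = v + w`, `v` the mild and `w` the caloric
  part of Lemma 3.1; it makes drifts built from `U` and `b` measurable, as Lemma 2.1 requires).
* The vorticity equation "`ωₜ + u∇ω − Δω = 0`" (p. 9; with `ωₜ ∈ L^∞`: "its time derivative is
  also uniformly bounded") is recorded as the identity between bounded continuous functions
  `ω(t, x) − ω(s, x) = ∫ₛᵗ (Δω(τ, ·)(x) − Dω(τ, ·)(x)[U(τ, x) + b(τ)]) dτ`, `s ≤ t < 0`, the shape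
  consumed by `KNSS2009_lemma21_halfball` with drift `a = U + b`.

## References

* G. Koch, N. Nadirashvili, G. Seregin, V. Šverák, *Liouville theorems for the Navier–Stokes
  equations and applications*, Acta Math. 203 (2009) 83–105 = arXiv:0709.3599 (arXiv page
  numbers, as in `KNSSLiouville`): §3 Lemma 3.1, Remark 3.1 (p. 7); §4, regularity of bounded weak
  solutions (p. 8, from "We now turn to regularity properties of bounded weak solutions" to the
  end of the section); §5 Theorem 5.1 and its proof (p. 9). [KochNadirashviliSereginSverak2009]
-/

noncomputable section

open MeasureTheory Set Function Filter TopologicalSpace InnerProductSpace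
open scoped RealInnerProductSpace Laplacian ContDiff

namespace Literature.Analysis.FluidPDE

/-! ### The planar (scalar) vorticity -/

section Curl2

/-- The **scalar curl (vorticity) of a planar vector field**, `curl2 v x = ∂₀v₁(x) − ∂₁v₀(x)`
(KNSS 2009, proof of Theorem 5.1, first display: "In two space dimensions the vorticity is a scalar
quantity defined by `ω = u_{2,1} − u_{1,2}`", indices `0, 1` in Lean), with
`∂ⱼvᵢ(x) = Dv(x)eⱼ · eᵢ`, `eⱼ = EuclideanSpace.single j 1`, exactly as in the tree's
three-dimensional `curl` (whose third component this is). Junk value `0` where `v` is not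
differentiable (inherited from `fderiv`). [cite: KochNadirashviliSereginSverak2009, §5 proof of Thm 5.1, first display (arXiv p. 9)] -/
def curl2 (v : EuclideanSpace ℝ (Fin 2) → EuclideanSpace ℝ (Fin 2))
    (x : EuclideanSpace ℝ (Fin 2)) : ℝ :=
  fderiv ℝ v x (EuclideanSpace.single 0 1) 1 - fderiv ℝ v x (EuclideanSpace.single 1 1) 0

/-- The scalar curl as a **continuous linear form of the velocity gradient**:
`T ↦ (T e₀)₁ − (T e₁)₀` on `ℝ² →L[ℝ] ℝ²`, so that `curl2 v = curl2CLM ∘ Dv`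
(`curl2_eq_comp`). [folklore] -/
def curl2CLM : (EuclideanSpace ℝ (Fin 2) →L[ℝ] EuclideanSpace ℝ (Fin 2)) →L[ℝ] ℝ :=
  (EuclideanSpace.proj 1).comp
      (ContinuousLinearMap.apply ℝ (EuclideanSpace ℝ (Fin 2)) (EuclideanSpace.single 0 1)) -
    (EuclideanSpace.proj 0).comp
      (ContinuousLinearMap.apply ℝ (EuclideanSpace ℝ (Fin 2)) (EuclideanSpace.single 1 1))

/-- Unfolding `curl2CLM`. [folklore] -/
@[simp]
theorem curl2CLM_apply (T : EuclideanSpace ℝ (Fin 2) →L[ℝ] EuclideanSpace ℝ (Fin 2)) :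
    curl2CLM T = T (EuclideanSpace.single 0 1) 1 - T (EuclideanSpace.single 1 1) 0 := rfl

/-- Unfolding `curl2`. [folklore] -/
theorem curl2_apply (v : EuclideanSpace ℝ (Fin 2) → EuclideanSpace ℝ (Fin 2))
    (x : EuclideanSpace ℝ (Fin 2)) :
    curl2 v x =
      fderiv ℝ v x (EuclideanSpace.single 0 1) 1 - fderiv ℝ v x (EuclideanSpace.single 1 1) 0 :=
  rfl

/-- `curl2 v = curl2CLM ∘ Dv`: the planar vorticity is a fixed linear function of the velocity
gradient. [folklore] -/
theorem curl2_eq_comp (v : EuclideanSpace ℝ (Fin 2) → EuclideanSpace ℝ (Fin 2)) :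
    curl2 v = curl2CLM ∘ fderiv ℝ v := rfl

/-- The vorticity of the zero field vanishes. [folklore] -/
@[simp]
theorem curl2_zero : curl2 (0 : EuclideanSpace ℝ (Fin 2) → EuclideanSpace ℝ (Fin 2)) = 0 := by
  funext x
  simp [curl2]

/-- The vorticity of a constant field vanishes (the parasitic solutions `u = b(t)` are
irrotational). [folklore] -/
@[simp]
theorem curl2_const (c : EuclideanSpace ℝ (Fin 2)) : curl2 (fun _ => c) = 0 := by
  funext x
  simp [curl2]

end Curl2

/-! ### §4 for bounded weak solutions on `ℝ² × (−∞, 0)` -/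

section Regularity

/-- **KNSS 2009, §4 (regularity of bounded weak solutions), planar ancient form used in the proof
of Theorem 5.1** (Acta Math. 203 (2009) = arXiv:0709.3599; §4 p. 8, the regularity of bounded weak
solutions — Lemma 3.1 (p. 7) and the closing bounds `‖∇ᵏₓu‖_{L^∞(ℝⁿ×(δ,T))} ≤ C(k, δ, T, M)`,
`‖∇ᵏₓ∂ₜ(u − b)‖_{L^∞(ℝⁿ×(δ,T))} ≤ C`, `k = 0, 1, 2, …`, written for `u : ℝⁿ × (0, T) → ℝⁿ`,
here `n = 2`; §5 p. 9, proof of Theorem 5.1: "By the results of Section 4, the function `ω` is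
uniformly bounded together with its spatial derivatives. Moreover, its time derivative is also
uniformly bounded. The vorticity equation in dimension two is `ωₜ + u∇ω − Δω = 0`"). Let `u` be a
bounded weak solution of the Navier–Stokes equations (`ν = 1`) in `ℝ² × (−∞, 0)`
(`IsBoundedWeakNSSolutionOn (Iio 0)`). Then there are a velocity representative
`U : ℝ → ℝ² → ℝ²` and a bounded measurable `b : ℝ → ℝ²` (the parasitic part of Lemma 3.1,
`u = v + w + b(t)`, `‖b‖_{L^∞} ≤ C‖u‖_{L^∞}`) such that:
* `U` is jointly measurable, and `u(t, ·) = U(t, ·) + b(t)` a.e. in `x`, for a.e. `t < 0`;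
* every slice `U(t, ·)`, `t < 0`, is `C^∞` and divergence free, and for every `k` the `k`-th
  derivatives are bounded on `ℝ² × (−∞, 0)` (`‖∇ᵏₓu‖_{L^∞} ≤ C_k`, uniform on `(−∞, 0)` for an
  ancient solution, as asserted on p. 9);
* for every `k ≥ 1` the `k`-th spatial derivatives are Lipschitz in time, uniformly
  (`‖∇ᵏₓ∂ₜ(u − b)‖_{L^∞} ≤ C`; order `0` is deliberately not asserted, module docstring);
* the scalar vorticity `ω = curl2 U` (`ω = u_{2,1} − u_{1,2}`) satisfies the vorticity equation
  `ωₜ + u∇ω − Δω = 0`, i.e. `ωₜ = Δω − (u·∇)ω` with `u = U + b`, in time-integrated form: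
  `ω(t, x) − ω(s, x) = ∫ₛᵗ (Δω(τ, ·)(x) − Dω(τ, ·)(x)[U(τ, x) + b(τ)]) dτ` for all `x` and
  `s ≤ t < 0`.
This is the `ℝ²` twin of `KNSS2009_regularity_boundedWeak_ancient` (`ℝ³`, vorticity `curl`,
three-dimensional vorticity equation with stretching); it compresses Lemma 3.1, Proposition 4.1
and the bootstrap of §4 (Oseen kernel estimates of §3, Serrin's interior regularity), none of which
is in Mathlib or the tree. [cite: KochNadirashviliSereginSverak2009, §4 p. 8 (regularity of bounded weak solutions, closing L^∞ bounds) with Lemma 3.1 p. 7; §5 proof of Thm 5.1, vorticity equation (arXiv p. 9)] -/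
def KNSS2009_regularity_boundedWeak_ancient_planar : Prop :=
  ∀ ⦃u : ℝ → EuclideanSpace ℝ (Fin 2) → EuclideanSpace ℝ (Fin 2)⦄,
    IsBoundedWeakNSSolutionOn (Iio 0) isOpen_Iio 1 u →
    ∃ (U : ℝ → EuclideanSpace ℝ (Fin 2) → EuclideanSpace ℝ (Fin 2))
      (b : ℝ → EuclideanSpace ℝ (Fin 2)),
      Measurable b ∧ (∃ C : ℝ, ∀ t, ‖b t‖ ≤ C) ∧
      Measurable (uncurry U) ∧
      (∀ᵐ t ∂((volume : Measure ℝ).restrict (Iio 0)), u t =ᵐ[volume] fun x => U t x + b t) ∧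
      (∀ t < 0, ContDiff ℝ ∞ (U t)) ∧
      (∀ t < 0, VectorCalculus.IsDivFree (U t)) ∧
      (∀ k : ℕ, ∃ C : ℝ, ∀ t < 0, ∀ x, ‖iteratedFDeriv ℝ k (U t) x‖ ≤ C) ∧
      (∀ k : ℕ, 1 ≤ k → ∃ L : ℝ, ∀ s < 0, ∀ t < 0, ∀ x,
        ‖iteratedFDeriv ℝ k (U t) x - iteratedFDeriv ℝ k (U s) x‖ ≤ L * |t - s|) ∧
      (∀ x, ∀ s t : ℝ, s ≤ t → t < 0 →
        curl2 (U t) x - curl2 (U s) x =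
          ∫ τ in s..t, ((Δ (curl2 (U τ))) x - fderiv ℝ (curl2 (U τ)) x (U τ x + b τ)))

end Regularity

end Literature.Analysis.FluidPDE

end
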